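import Mathlib
import HarnessLib

/-!
# Bounded quadratic polynomials on the cube: multi-affine extension, eigenvector localisation, heavy rows

Solo seat `solo-QuantumAdvantage-informed`, session 11, file 28 (LEMMA L of the seat's paper, §4.26 (4)).

A ONE-query quantum algorithm's acceptance probability is a multilinear polynomial of degree `≤ 2`
(Beals–Buhrman–Cleve–Mosca–de Wolf), i.e. `q(x) = c + ⟨b, x⟩ + xᵀ A x` on `{−1,1}ⁿ` with `A` a real
matrix of zero diagonal, and `q(x) ∈ [0,1]` at every vertex. The seat's degree-2 simulation theorems
(Theorem C′, Proposition E of the paper) rest on four structural facts about such `q`; this file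
kernel-checks the three that are not bookkeeping:

* `quadForm_cube_extension` — MULTI-AFFINE EXTENSION: if `A` has zero diagonal and `c + xᵀAx ∈ [lo, hi]`
  at every vertex, then `c + yᵀAy ∈ [lo, hi]` on the whole solid cube `[−1,1]ⁿ` (the form is affine in
  each coordinate separately, so its range over the cube is the range over the vertices; induction on
  the number of non-vertex coordinates).
* `eigenvalue_localization` (F2) — for every eigenpair `A u = λ u` and every `M > 0` bounding the
  entries of `u`: `|λ| · ‖u‖₂² ≤ M²`; i.e. a unit eigenvector has a coordinate of squared size `≥ |λ|`
  (apply the extension to `y = u / M`). In particular `‖A‖_op ≤ 1`, and eigenvectors of large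
  eigenvalues are LOCALISED — the fact that drives the seat's deletion / capture conjectures (DC, CC).
* `heavy_row` (F3) — some row has energy `∑_j A_{ij}² ≥ |λ|³` for every eigenvalue `λ` of `A`
  (Cauchy–Schwarz on the localised coordinate); this is what lets an influence-type greedy step see the
  operator norm (the paper's PHASE I-op), sharp up to the constant `4` on the two-block example.
* `linear_part_l1_le` (F1) — `2 · ‖b‖₁ ≤ hi − lo` (evaluate at `x = sgn b` and `−x`).
* `bounded_quadratic_structure` — the four facts assembled in the paper's normalisation `q ∈ [0,1]`:
  `‖b‖₁ ≤ ½`, `c + yᵀAy ∈ [0,1]` on the cube, F2, F3.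

Elementary and self-contained (Mathlib only). The solid-cube step is standard (e.g. Defant–Mastyło–Pérez,
arXiv:1706.03670, p. 9, for multi-affine forms); F2/F3 in this form were searched for and not found in
print (seat paper, referee-notes item 45) — they are exercises, recorded here because the seat's
conjectures DC/CC are stated over exactly these hypotheses.
-/

namespace Summit.QuantumAdvantage.QuantumAdvantage.Theorems

namespace BoundedQuadratic

open Finset

variable {n : ℕ}

/-- The quadratic form `y ↦ yᵀ A y = ∑_{i,j} A i j · y i · y j` of a real square matrix. -/
def quadForm (A : Matrix (Fin n) (Fin n) ℝ) (y : Fin n → ℝ) : ℝ :=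
  ∑ i, ∑ j, A i j * y i * y j

/-- Vertices of the cube: sign vectors `x ∈ {−1,1}ⁿ`. -/
def IsSignVec (x : Fin n → ℝ) : Prop := ∀ i, x i = 1 ∨ x i = -1

/-- Points of the solid cube `[−1,1]ⁿ`. -/
def InCube (y : Fin n → ℝ) : Prop := ∀ i, |y i| ≤ 1

/-- Vertices lie in the solid cube. -/
lemma IsSignVec.inCube {x : Fin n → ℝ} (hx : IsSignVec x) : InCube x := by
  intro i; rcases hx i with h | h <;> simp [h]

/-- The part of `yᵀAy` not involving coordinate `i`. -/
def lineConst (A : Matrix (Fin n) (Fin n) ℝ) (y : Fin n → ℝ) (i : Fin n) : ℝ :=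
  ∑ j ∈ univ.erase i, ∑ k ∈ univ.erase i, A j k * y j * y k

/-- The coefficient of `w i` in `wᵀAw` along the `i`-th coordinate line through `y`. -/
def lineCoeff (A : Matrix (Fin n) (Fin n) ℝ) (y : Fin n → ℝ) (i : Fin n) : ℝ :=
  ∑ k ∈ univ.erase i, A i k * y k + ∑ j ∈ univ.erase i, A j i * y j

/-- **Affine in each coordinate.** If `A i i = 0` and `w` agrees with `y` off coordinate `i`, then
`wᵀAw = lineConst A y i + w i · lineCoeff A y i`. -/
theorem quadForm_eq_of_agree_off (A : Matrix (Fin n) (Fin n) ℝ) {i : Fin n} (hAii : A i i = 0)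
    {w y : Fin n → ℝ} (h : ∀ j, j ≠ i → w j = y j) :
    quadForm A w = lineConst A y i + w i * lineCoeff A y i := by
  classical
  unfold quadForm lineConst lineCoeff
  rw [← Finset.add_sum_erase _ _ (mem_univ i)]
  rw [← Finset.add_sum_erase _ _ (mem_univ i)]
  have hin : ∀ j ∈ univ.erase i,
      ∑ k, A j k * w j * w k = A j i * y j * w i + ∑ k ∈ univ.erase i, A j k * y j * y k := by
    intro j hj
    have hji : j ≠ i := (mem_erase.mp hj).1
    rw [← Finset.add_sum_erase _ _ (mem_univ i), h j hji]
    congr 1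
    apply sum_congr rfl
    intro k hk
    rw [h k (mem_erase.mp hk).1]
  rw [sum_congr rfl hin, sum_add_distrib, hAii]
  have h1 : ∑ k ∈ univ.erase i, A i k * w i * w k = w i * ∑ k ∈ univ.erase i, A i k * y k := by
    rw [mul_sum]
    refine sum_congr rfl fun k hk => ?_
    rw [h k (mem_erase.mp hk).1]; ring
  have h2 : ∑ j ∈ univ.erase i, A j i * y j * w i = w i * ∑ j ∈ univ.erase i, A j i * y j := by
    rw [mul_sum]
    exact sum_congr rfl fun j _ => by ring
  rw [h1, h2]; ring

/-- The number of coordinates of `y` that are not `±1`. -/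
noncomputable def nonVert (y : Fin n → ℝ) : ℕ := (univ.filter fun i => ¬ (y i = 1 ∨ y i = -1)).card

/-- Moving a non-vertex coordinate of a cube point to `±1`: still in the cube, one fewer non-vertex
coordinate, agrees elsewhere. -/
lemma neighbour_facts (y : Fin n → ℝ) (hy : InCube y) (i : Fin n) (hi : ¬ (y i = 1 ∨ y i = -1))
    (t : ℝ) (ht : t = 1 ∨ t = -1) :
    InCube (Function.update y i t) ∧ nonVert (Function.update y i t) + 1 ≤ nonVert y ∧
      (∀ j, j ≠ i → Function.update y i t j = y j) ∧ Function.update y i t i = t := by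
  classical
  have hoff : ∀ j, j ≠ i → Function.update y i t j = y j := fun j hj => Function.update_of_ne hj _ _
  have hon : Function.update y i t i = t := Function.update_self _ _ _
  refine ⟨?_, ?_, hoff, hon⟩
  · intro j
    by_cases hji : j = i
    · subst hji
      rw [hon]
      rcases ht with h | h <;> simp [h]
    · rw [hoff j hji]
      exact hy j
  · have hsub : (univ.filter fun j => ¬ (Function.update y i t j = 1 ∨ Function.update y i t j = -1))
        ⊆ (univ.filter fun j => ¬ (y j = 1 ∨ y j = -1)).erase i := by
      intro j hj
      rw [mem_filter] at hj
      have hji : j ≠ i := by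
        rintro rfl
        exact hj.2 (by rw [hon]; exact ht)
      rw [mem_erase, mem_filter]
      exact ⟨hji, mem_univ _, by rw [← hoff j hji]; exact hj.2⟩
    have hmem : i ∈ univ.filter (fun j => ¬ (y j = 1 ∨ y j = -1)) := by
      rw [mem_filter]
      exact ⟨mem_univ _, hi⟩
    have hcard := card_le_card hsub
    rw [Finset.card_erase_of_mem hmem] at hcard
    have hpos : 0 < (univ.filter fun j => ¬ (y j = 1 ∨ y j = -1)).card := card_pos.mpr ⟨i, hmem⟩
    unfold nonVert
    omega

/-- **Multi-affine extension to the solid cube.** If `A` has zero diagonal and `c + xᵀAx ∈ [lo, hi]`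
at every vertex of the cube, then `c + yᵀAy ∈ [lo, hi]` at every point of the solid cube. -/
theorem quadForm_cube_extension (A : Matrix (Fin n) (Fin n) ℝ) (hdiag : ∀ i, A i i = 0)
    {c lo hi : ℝ}
    (hbd : ∀ x, IsSignVec x → lo ≤ c + quadForm A x ∧ c + quadForm A x ≤ hi)
    (y : Fin n → ℝ) (hy : InCube y) : lo ≤ c + quadForm A y ∧ c + quadForm A y ≤ hi := by
  classical
  suffices H : ∀ m : ℕ, ∀ y : Fin n → ℝ, InCube y → nonVert y ≤ m →
      lo ≤ c + quadForm A y ∧ c + quadForm A y ≤ hi from H _ y hy le_rfl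
  intro m
  induction m with
  | zero =>
    intro y hy hm
    apply hbd
    intro i
    by_contra hi
    have hmem : i ∈ univ.filter (fun j => ¬ (y j = 1 ∨ y j = -1)) := by
      rw [mem_filter]
      exact ⟨mem_univ _, hi⟩
    have hpos : 0 < nonVert y := card_pos.mpr ⟨i, hmem⟩
    omega
  | succ m ih =>
    intro y hy hm
    by_cases hv : IsSignVec y
    · exact hbd y hv
    · obtain ⟨i, hi⟩ : ∃ i, ¬ (y i = 1 ∨ y i = -1) := by
        by_contra hall
        push Not at hall
        exact hv (fun i => hall i)
      obtain ⟨hcp, hnp, hoffp, honp⟩ := neighbour_facts y hy i hi 1 (Or.inl rfl)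
      obtain ⟨hcm, hnm, hoffm, honm⟩ := neighbour_facts y hy i hi (-1) (Or.inr rfl)
      have Hp := ih _ hcp (by omega)
      have Hm := ih _ hcm (by omega)
      have ep := quadForm_eq_of_agree_off A (hdiag i) hoffp
      have em := quadForm_eq_of_agree_off A (hdiag i) hoffm
      have e0 : quadForm A y = lineConst A y i + y i * lineCoeff A y i :=
        quadForm_eq_of_agree_off A (hdiag i) (fun j _ => rfl)
      rw [honp] at ep
      rw [honm] at em
      have hyi := abs_le.mp (hy i)
      have key : c + quadForm A y =
          (1 + y i) / 2 * (c + quadForm A (Function.update y i 1)) +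
            (1 - y i) / 2 * (c + quadForm A (Function.update y i (-1))) := by
        rw [e0, ep, em]
        ring
      have hw1 : 0 ≤ (1 + y i) / 2 := by linarith [hyi.1]
      have hw2 : 0 ≤ (1 - y i) / 2 := by linarith [hyi.2]
      constructor
      · rw [key]
        nlinarith [Hp.1, Hm.1, hw1, hw2]
      · rw [key]
        nlinarith [Hp.2, Hm.2, hw1, hw2]

/-- Absolute-value form of the extension for the pure quadratic part. -/
theorem quadForm_abs_le_on_cube (A : Matrix (Fin n) (Fin n) ℝ) (hdiag : ∀ i, A i i = 0)
    (hbd : ∀ x, IsSignVec x → |quadForm A x| ≤ 1) (y : Fin n → ℝ) (hy : InCube y) :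
    |quadForm A y| ≤ 1 := by
  have h := quadForm_cube_extension A hdiag (c := 0) (lo := -1) (hi := 1)
    (fun x hx => by
      have := abs_le.mp (hbd x hx)
      constructor <;> linarith [this.1, this.2]) y hy
  rw [abs_le]
  constructor <;> linarith [h.1, h.2]

/-- Rayleigh identity: for an eigenpair `A u = λ u`, `uᵀAu = λ ‖u‖₂²`. -/
theorem quadForm_eigenvec (A : Matrix (Fin n) (Fin n) ℝ) {u : Fin n → ℝ} {lam : ℝ}
    (hu : ∀ i, ∑ j, A i j * u j = lam * u i) :
    quadForm A u = lam * ∑ i, u i ^ 2 := by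
  unfold quadForm
  rw [mul_sum]
  apply sum_congr rfl
  intro i _
  have : ∑ j, A i j * u i * u j = u i * ∑ j, A i j * u j := by
    rw [mul_sum]; exact sum_congr rfl fun j _ => by ring
  rw [this, hu i]; ring

/-- Homogeneity of degree two. -/
theorem quadForm_smul (A : Matrix (Fin n) (Fin n) ℝ) (y : Fin n → ℝ) (s : ℝ) :
    quadForm A (fun i => s * y i) = s ^ 2 * quadForm A y := by
  unfold quadForm
  rw [mul_sum]
  refine sum_congr rfl fun i _ => ?_
  rw [mul_sum]; exact sum_congr rfl fun j _ => by ring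

/-- **F2 — eigenvector localisation.** If `A` has zero diagonal and `|xᵀAx| ≤ 1` at every vertex,
then for every eigenpair `A u = λ u` and every `M > 0` with `|u i| ≤ M` for all `i`:
`|λ| · ∑ u_i² ≤ M²`. For a unit eigenvector: `max_i u_i² ≥ |λ|`; in particular `|λ| ≤ 1`. -/
theorem eigenvalue_localization (A : Matrix (Fin n) (Fin n) ℝ) (hdiag : ∀ i, A i i = 0)
    (hbd : ∀ x, IsSignVec x → |quadForm A x| ≤ 1) {u : Fin n → ℝ} {lam : ℝ}
    (hu : ∀ i, ∑ j, A i j * u j = lam * u i) {M : ℝ} (hM : 0 < M) (huM : ∀ i, |u i| ≤ M) :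
    |lam| * ∑ i, u i ^ 2 ≤ M ^ 2 := by
  have hM0 : M ≠ 0 := hM.ne'
  have hcube : InCube (fun i => M⁻¹ * u i) := by
    intro i
    rw [abs_mul, abs_inv, abs_of_pos hM]
    calc M⁻¹ * |u i| ≤ M⁻¹ * M := by gcongr; exact huM i
      _ = 1 := inv_mul_cancel₀ hM0
  have hS : 0 ≤ ∑ i, u i ^ 2 := sum_nonneg (fun i _ => sq_nonneg _)
  have h1 : |(M⁻¹) ^ 2 * (lam * ∑ i, u i ^ 2)| ≤ 1 := by
    rw [← quadForm_eigenvec A hu, ← quadForm_smul]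
    exact quadForm_abs_le_on_cube A hdiag hbd _ hcube
  rw [abs_mul, abs_mul, abs_of_nonneg hS, abs_of_nonneg (by positivity : (0:ℝ) ≤ (M⁻¹) ^ 2)] at h1
  calc |lam| * ∑ i, u i ^ 2 = M ^ 2 * ((M⁻¹) ^ 2 * (|lam| * ∑ i, u i ^ 2)) := by
        field_simp
    _ ≤ M ^ 2 * 1 := by gcongr
    _ = M ^ 2 := mul_one _

/-- **F3 — heavy row.** Under the same hypotheses, for every eigenpair `A u = λ u` with `u ≠ 0` some
row of `A` has energy `∑_j A_{ij}² ≥ |λ|³`. -/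
theorem heavy_row (A : Matrix (Fin n) (Fin n) ℝ) (hdiag : ∀ i, A i i = 0)
    (hbd : ∀ x, IsSignVec x → |quadForm A x| ≤ 1) {u : Fin n → ℝ} {lam : ℝ}
    (hu : ∀ i, ∑ j, A i j * u j = lam * u i) (hne : u ≠ 0) :
    ∃ i, |lam| ^ 3 ≤ ∑ j, A i j ^ 2 := by
  classical
  have hn : (univ : Finset (Fin n)).Nonempty := by
    rw [univ_nonempty_iff]
    by_contra h
    rw [not_nonempty_iff] at h
    exact hne (funext fun i => (IsEmpty.false i).elim)
  obtain ⟨i, -, hi⟩ := exists_max_image univ (fun j => |u j|) hn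
  refine ⟨i, ?_⟩
  have hM : 0 < |u i| := by
    by_contra h0
    push Not at h0
    apply hne
    funext j
    have hj : |u j| ≤ 0 := (hi j (mem_univ j)).trans h0
    exact abs_eq_zero.mp (le_antisymm hj (abs_nonneg _))
  have hui : u i ≠ 0 := abs_pos.mp hM
  set S := ∑ j, u j ^ 2 with hSdef
  have hS : 0 < S := by
    have h1 : u i ^ 2 ≤ S :=
      single_le_sum (f := fun j => u j ^ 2) (fun j _ => sq_nonneg (u j)) (mem_univ i)
    have h2 : 0 < u i ^ 2 := by positivity
    linarith
  have hF2 : |lam| * S ≤ |u i| ^ 2 :=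
    eigenvalue_localization A hdiag hbd hu hM (fun j => hi j (mem_univ j))
  have hCS : (∑ j, A i j * u j) ^ 2 ≤ (∑ j, A i j ^ 2) * S :=
    sum_mul_sq_le_sq_mul_sq univ (fun j => A i j) u
  rw [hu i] at hCS
  have habs3 : |lam| ^ 3 = lam ^ 2 * |lam| := by
    rw [← sq_abs lam]
    ring
  have h3 : |lam| ^ 3 * S ≤ (∑ j, A i j ^ 2) * S := by
    calc |lam| ^ 3 * S = lam ^ 2 * (|lam| * S) := by rw [habs3]; ring
      _ ≤ lam ^ 2 * |u i| ^ 2 := by gcongr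
      _ = (lam * u i) ^ 2 := by rw [sq_abs]; ring
      _ ≤ (∑ j, A i j ^ 2) * S := hCS
  exact le_of_mul_le_mul_right h3 hS

/-- **F1 — the linear part is `ℓ₁`-small.** If `c + ⟨b,x⟩ + xᵀAx ∈ [lo, hi]` at every vertex then
`2‖b‖₁ ≤ hi − lo` (no hypothesis on `A`: evaluate at `x = sgn b` and at `−x`). -/
theorem linear_part_l1_le (c : ℝ) (b : Fin n → ℝ) (A : Matrix (Fin n) (Fin n) ℝ) {lo hi : ℝ}
    (hbd : ∀ x, IsSignVec x →
      lo ≤ c + ∑ i, b i * x i + quadForm A x ∧ c + ∑ i, b i * x i + quadForm A x ≤ hi) :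
    2 * ∑ i, |b i| ≤ hi - lo := by
  classical
  set x : Fin n → ℝ := fun i => if 0 ≤ b i then 1 else -1 with hxdef
  have hx : IsSignVec x := by
    intro i
    by_cases h : 0 ≤ b i <;> simp [hxdef, h]
  have hnx : IsSignVec (fun i => - x i) := by
    intro i
    rcases hx i with h | h <;> simp [h]
  have hq : quadForm A (fun i => - x i) = quadForm A x := by
    unfold quadForm
    exact sum_congr rfl fun i _ => sum_congr rfl fun j _ => by ring
  have hbx : ∑ i, b i * x i = ∑ i, |b i| := by
    apply sum_congr rfl
    intro i _
    by_cases h : 0 ≤ b i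
    · simp [hxdef, h, abs_of_nonneg h]
    · have h' : b i < 0 := lt_of_not_ge h
      simp [hxdef, h, abs_of_neg h']
  have hbnx : ∑ i, b i * (- x i) = - ∑ i, |b i| := by
    rw [← hbx, ← sum_neg_distrib]; exact sum_congr rfl fun i _ => by ring
  have h1 := (hbd x hx).2
  have h2 := (hbd _ hnx).1
  rw [hbnx, hq] at h2
  rw [hbx] at h1
  linarith

/-- **LEMMA L (paper normalisation).** For `q(x) = c + ⟨b,x⟩ + xᵀAx ∈ [0,1]` on `{−1,1}ⁿ` with `A` of
zero diagonal: (F1) `‖b‖₁ ≤ ½`; (cube) `c + yᵀAy ∈ [0,1]` on `[−1,1]ⁿ`, hence `|yᵀAy| ≤ 1` there;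
(F2) every eigenpair `A u = λ u` has `|λ|‖u‖₂² ≤ M²` whenever `|u_i| ≤ M` (`M > 0`);
(F3) for `u ≠ 0` some row has `∑_j A_{ij}² ≥ |λ|³`. -/
theorem bounded_quadratic_structure (c : ℝ) (b : Fin n → ℝ) (A : Matrix (Fin n) (Fin n) ℝ)
    (hdiag : ∀ i, A i i = 0)
    (hbd : ∀ x, IsSignVec x →
      0 ≤ c + ∑ i, b i * x i + quadForm A x ∧ c + ∑ i, b i * x i + quadForm A x ≤ 1) :
    (∑ i, |b i| ≤ 1 / 2) ∧
    (∀ y, InCube y → 0 ≤ c + quadForm A y ∧ c + quadForm A y ≤ 1) ∧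
    (∀ y, InCube y → |quadForm A y| ≤ 1) ∧
    (∀ (u : Fin n → ℝ) (lam : ℝ), (∀ i, ∑ j, A i j * u j = lam * u i) →
      ∀ M : ℝ, 0 < M → (∀ i, |u i| ≤ M) → |lam| * ∑ i, u i ^ 2 ≤ M ^ 2) ∧
    (∀ (u : Fin n → ℝ) (lam : ℝ), (∀ i, ∑ j, A i j * u j = lam * u i) → u ≠ 0 →
      ∃ i, |lam| ^ 3 ≤ ∑ j, A i j ^ 2) := by
  classical
  -- F1
  have hF1 : ∑ i, |b i| ≤ 1 / 2 := by
    have := linear_part_l1_le c b A hbd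
    linarith
  -- the even part `c + xᵀAx = (q(x) + q(−x))/2 ∈ [0,1]` at every vertex
  have heven : ∀ x, IsSignVec x → 0 ≤ c + quadForm A x ∧ c + quadForm A x ≤ 1 := by
    intro x hx
    have hnx : IsSignVec (fun i => - x i) := by
      intro i
      rcases hx i with h | h <;> simp [h]
    have hq : quadForm A (fun i => - x i) = quadForm A x := by
      unfold quadForm
      exact sum_congr rfl fun i _ => sum_congr rfl fun j _ => by ring
    have hl : ∑ i, b i * (- x i) = - ∑ i, b i * x i := by
      rw [← sum_neg_distrib]; exact sum_congr rfl fun i _ => by ring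
    have h1 := hbd x hx
    have h2 := hbd _ hnx
    rw [hl, hq] at h2
    constructor <;> linarith [h1.1, h1.2, h2.1, h2.2]
  have hcube : ∀ y, InCube y → 0 ≤ c + quadForm A y ∧ c + quadForm A y ≤ 1 :=
    fun y hy => quadForm_cube_extension A hdiag heven y hy
  -- `c ∈ [0,1]` (the centre of the cube) and hence `|yᵀAy| ≤ 1` on the cube
  have hc : 0 ≤ c ∧ c ≤ 1 := by
    have h0 := hcube (fun _ => 0) (fun i => by simp)
    have hq0 : quadForm A (fun _ => (0:ℝ)) = 0 := by
      unfold quadForm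
      simp
    rw [hq0, add_zero] at h0
    exact h0
  have habs : ∀ y, InCube y → |quadForm A y| ≤ 1 := by
    intro y hy
    have h := hcube y hy
    rw [abs_le]
    constructor <;> linarith [h.1, h.2, hc.1, hc.2]
  have hsgn : ∀ x, IsSignVec x → |quadForm A x| ≤ 1 := fun x hx => habs x hx.inCube
  refine ⟨hF1, hcube, habs, ?_, ?_⟩
  · intro u lam hu M hM huM
    exact eigenvalue_localization A hdiag hsgn hu hM huM
  · intro u lam hu hne
    exact heavy_row A hdiag hsgn hu hne

end BoundedQuadratic

end Summit.QuantumAdvantage.QuantumAdvantage.Theorems
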